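import Mathlib
import Summits.Ventures.PercRepro2.StepZeroOfAS3

/-!
# The hand-over move of (AS3): every source has a target strictly below it
(seat mine-b, cell pub-perc-repro2; conjectures/MINE-B.md §12.4 (d), Addendum 4)

For increasing `A`, `B` on the cube `𝒫(U)`, a SOURCE of the level-refined Reimer statement (AS3) is a
configuration `γ` with `A □ B` at `γ` whose red side `U \ γ` is not in `B`; a TARGET is a `δ ∈ A` whose
red side is in `B` but carries no two disjoint `B`-witnesses.  The hand-over move: take the blue
`B`-witness `L` (disjoint from a blue `A`-witness `K`) and a MINIMAL subset `M ⊆ L` such that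
`(U \ γ) ∪ M ∈ B`; then `δ = γ \ M` is a target — minimality of `M` forces the new red side to be at
level exactly `1` (two disjoint witnesses inside `(U \ γ) ∪ M` would both have to meet `M`, and one of
them would then miss an element of `M`, contradicting minimality), and `K ⊆ δ` keeps `δ ∈ A`.
So the comparability relation «target ⊊ source» of (AS3)'s Hall form has no isolated source
(`AS3_source_has_target`); the conjecture is that it satisfies Hall's condition.
-/

open Finset

namespace Summit.Ventures.PercRepro2

namespace StepZero

open ReimerCube

variable {E : Type*} [DecidableEq E]

/-- **Every (AS3) source has a hand-over target strictly below it.** -/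
theorem AS3_source_has_target (U : Finset E) {A B : Finset E → Prop} (hA : Incr A) (hB : Incr B)
    {γ : Finset E} (hγU : γ ⊆ U) (hsrc : DOcc A B γ) (hred : ¬ B (U \ γ)) :
    ∃ δ, δ ⊂ γ ∧ A δ ∧ B (U \ δ) ∧ ¬ DOcc B B (U \ δ) := by
  classical
  obtain ⟨K, L, hK, hL, hKL, hAK, hBL⟩ := hsrc
  have hBL' : B L := hBL L le_rfl
  have hAK' : A K := hAK K le_rfl
  -- the candidates: subsets `M ⊆ L` with `(U \ γ) ∪ M ∈ B`; `L` itself is one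
  set cand := L.powerset.filter (fun M => B ((U \ γ) ∪ M)) with hcand
  have hLc : L ∈ cand := by
    rw [hcand, Finset.mem_filter, Finset.mem_powerset]
    exact ⟨le_rfl, hB Finset.subset_union_right hBL'⟩
  obtain ⟨M, hMc, hMmin⟩ := Finset.exists_min_image cand Finset.card ⟨L, hLc⟩
  rw [hcand, Finset.mem_filter, Finset.mem_powerset] at hMc
  obtain ⟨hML, hBM⟩ := hMc
  -- `M` is nonempty: otherwise the red side itself would be in `B`
  have hMne : M.Nonempty := by
    rw [Finset.nonempty_iff_ne_empty]
    rintro rfl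
    exact hred (by simpa using hBM)
  refine ⟨γ \ M, ?_, ?_, ?_, ?_⟩
  · -- strictly smaller
    obtain ⟨m, hm⟩ := hMne
    refine Finset.ssubset_iff_subset_ne.mpr ⟨Finset.sdiff_subset, ?_⟩
    intro h
    have hmγ : m ∈ γ := hL (hML hm)
    rw [← h] at hmγ
    exact (Finset.mem_sdiff.mp hmγ).2 hm
  · -- `A`: the witness `K` survives (it is disjoint from `L ⊇ M`)
    apply hA _ hAK'
    intro x hx
    exact Finset.mem_sdiff.mpr ⟨hK hx, fun hxM => Finset.disjoint_left.mp hKL hx (hML hxM)⟩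
  · -- `B` on the new red side `(U \ γ) ∪ M`
    have e : U \ (γ \ M) = (U \ γ) ∪ M := by
      rw [Finset.sdiff_sdiff_eq_sdiff_union (hML.trans (hL.trans hγU))]
    rw [e]
    exact hBM
  · -- level exactly one, by minimality of `M`
    have e : U \ (γ \ M) = (U \ γ) ∪ M := by
      rw [Finset.sdiff_sdiff_eq_sdiff_union (hML.trans (hL.trans hγU))]
    rw [e]
    rintro ⟨K', L', hK', hL', hK'L', hBK', hBL'⟩
    have hK'B : B K' := hBK' K' le_rfl
    have hL'B : B L' := hBL' L' le_rfl
    -- both witnesses meet `M` (otherwise they lie in `U \ γ ∉ B`)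
    have meet : ∀ W, W ⊆ (U \ γ) ∪ M → B W → ∃ m ∈ M, m ∈ W := by
      intro W hW hBW
      by_contra hno
      push Not at hno
      apply hred
      apply hB _ hBW
      intro x hx
      rcases Finset.mem_union.mp (hW hx) with h | h
      · exact h
      · exact absurd hx (hno x h)
    obtain ⟨m, hmM, hmL'⟩ := meet L' hL' hL'B
    -- `K'` avoids `m`, so `K' ⊆ (U \ γ) ∪ (M.erase m)`: a smaller candidate
    have hK'sub : K' ⊆ (U \ γ) ∪ M.erase m := by
      intro x hx
      rcases Finset.mem_union.mp (hK' hx) with h | h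
      · exact Finset.mem_union_left _ h
      · refine Finset.mem_union_right _ (Finset.mem_erase.mpr ⟨?_, h⟩)
        rintro rfl
        exact Finset.disjoint_left.mp hK'L' hx hmL'
    have hsmall : M.erase m ∈ cand := by
      rw [hcand, Finset.mem_filter, Finset.mem_powerset]
      exact ⟨(Finset.erase_subset m M).trans hML, hB hK'sub hK'B⟩
    have := hMmin _ hsmall
    rw [Finset.card_erase_of_mem hmM] at this
    have hpos : 0 < M.card := Finset.card_pos.mpr ⟨m, hmM⟩
    omega

end StepZero

end Summit.Ventures.PercRepro2
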